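import Summits.QuantumFields.YangMills.Theorems.BalabanUVNodesN15CovariantAveragingLetters
import HarnessLib

/-!
# Route «BalabanUVNodes», node N15 = NE2, road (c) — PROGRAMME (P-Q), IVa: THE TWO-GRID η-DEFECT OF THE COVARIANT AVERAGING SHAPE THROUGH KING's PAIRING —
# `Q′_{W′}∘P̂ − Q_W` (and, in the sequel, `Q′*_{W′} − P̂∘Q*_W`) is `≤ (φ + 2B·η)·e^{ρ′}·e^{−ρ′d}` blockwise, `φ` the fit between each fine transport and its projected coarse partner,
# `B` the kernel size, `η = L^{−k}`: the multiplicities of the fine line over the coarse one match exactly except one boundary term per line (telescoping)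

Cell `pub-ymgap`, seat `pub-ymgap-dag-n15-c` (generation g21; R134 (a) seat, strategy s1; HUMAN RULING D-0062; chair R424 venue).  `bears_on: R4∕N15 · K3⁸ SpineGivenEndpointR13SepCoPHV
(stmt-QuantumFields-27366)`; filed `--supports stmt-QuantumFields-27366 --as helper` — COUNT-NEUTRAL.  THEOREMS only ([folklore] lattice combinatorics + block-majorant bookkeeping), 0 `def`,
0 `sorry`.  Imports BY NAME, nothing in the tree modified ∕ restated: n15-c∕181 `…CovariantAveragingObjects` (`qvKer`, `qvAdjKer`, `qvKer_apply`, `qvAdjKer_apply`), n15-c∕182b (through it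
`…TwoGridLocality`: `tdistT_blockOf_add_smul_le`; `…TwoGridConsistency`: `kingPr_add_smul_unitVec_of_le`; `…TwoGridTransports`: `kingPr_add_smul_unitVec`), n15-a `kingPr`∕`kingPrV`∕`kingPr_val`,
n15-b `liftMap`∕`liftBlk`, King's `blockOf_over`, `card_fibre_blockOf`, the Literature's `HasMaj`∕`pull`∕`abs_le_loc_ofBlocks`∕`loc_ofBlocks_le`.

WHY.  FILE 123 (`uN_idef_cvGlued`) asks, besides the one-grid letters of `N_V` (n15-c∕182b∕183), for its TWO-GRID defect row `hDNV`: `𝔇(N_V′, N_V) = N_V′∘P̂ − P̂∘N_V ≤ o_N e^{−δd}` with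
`o_N` an η-RATE letter (`P̂ = pull (liftMap kingPrV ι)` King's piecewise-constant prolongation).  With `N_V^Q = a(Q*Q ⊗ 1 − Q*(U)Q(U))` and Leibniz
(`Q′*Q′P̂ − P̂Q*Q = Q′*(Q′P̂ − Q) + (Q′* − P̂Q*)Q`, both grids sharing the unit lattice) everything reduces to the two defects of THIS file for the covariant shapes (the flat ones are
dag-n15-a parts 35–37).  THE MECHANISM (one level of [Balaban1985BackgroundPropagators] (3.73)∕King's Prop. 3.9 bookkeeping for an `x`-DEPENDENT matrix kernel): write the fine line
index `s′ = L^m s + j` (`s < L^k`, `j < L^m`) and the fine block points over the coarse ones (`(L^m)^{d+1}` each, King's `card_fibre`); the fine bond point `x′ + s′e′` projects to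
`πx′ + (s + δ)e` with `δ = δ(x′, j) ∈ {0, 1}` (`kingPr_add_smul_unitVec_of_le`); partner the fine term `(x′, s′)` with the coarse term `(πx′, s + δ)`: the kernels differ by the FIT
`φ` (hypothesis; the sequel produces it from this seat's g4 `norm_stairProd_two_spacing_le`), and the re-indexed coarse terms `s ↦ s + δ` TELESCOPE against the original ones
(`Finset.sum_range_sub`), leaving one boundary term `g(L^k) − g(0)` of size `2B` per `(x′, j)` with `δ = 1` — weight `L^m∕(L^mL^k) = η` after averaging.  Same for the adjoint
shape with columns, the borrow `δ′` of `π(x′ − je′)` and the block identity `B′(p′) = B(πp′)` (`blockOf_over`).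

RESULTS ([folklore]; (1.18)∕(3.73) tags mark shapes, nothing printed is asserted).
* §1 two-grid arithmetic: `sum_range_mul_eq` (`Σ_{s′<Rn} = Σ_{s<n}Σ_{j<R} (Rs + j)`), `kingPr_add_mul_smul` (`π(z + L^m s·e′) = πz + s·e`), `blockOf_kingPr` (`B(πx′) = B′(x′)`),
  `sum_fibre_fine_eq` (`Σ_{x′∈B′(y)} F(πx′) = (L^m)^{d+1}·Σ_{x∈B(y)} F(x)`), `kingPr_sub_smul_eq` (the borrow: `π(x′ − je′) = πx′ − δ′e`, `δ′ ≤ 1`).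
* §2 ★★ **`hasMaj_qvKer_twoGrid`**: kernel size `rows W(p, s) ≤ B` (`s ≤ L^k`), fit `rows(W′(x′, μ)(L^ms + j) − W(πx′, μ)(s + δ)) ≤ φ` whenever `π(x′ + je′) = πx′ + δe` (`δ ≤ 1`)
  ⟹ `Q′_{W′}∘P̂ − Q_W ≤ (φ + 2B∕L^k)·e^{ρ′}·e^{−ρ′|y−y′|_T}` (coarse coloured 1-forms blocked by unit blocks → unit-lattice ones), every `ρ′ ≥ 0`.
* (sequel n15-c∕184b `…CovariantAveragingTwoGridAdjoint`: the adjoint shape `Q′*_{W′} − P̂∘Q*_W`, same bound with columns and the borrow `δ′`.)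

HONEST FRAMING ∕ LIMITS.  Generic lattice bookkeeping for the MODEL shapes of n15-c∕181 (arbitrary matrix path kernels `W`, `W′`); the fits `φ` are HYPOTHESES here (the sequel: transport
fits of `cvaPath` at two spacings from the (3.35) letters); no estimate of Bałaban's; one pairing level (King's `⌊·∕L^m⌋`).  NE2⁺ NOT PRINTED; N15 of record untouched (DISCHARGED AS
CONSUMED); counts UNMOVED (typed 28∕28); one finite 𝕋⁴ at fixed ε per index — NOT infinite volume ∕ OS ∕ mass gap ∕ Clay.  Restate-immune (no Theses import).
-/

noncomputable section

open scoped BigOperators Matrix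
open Finset

namespace Summit.QuantumFields.YangMills.BalabanUVNodes.N15.CovAvg

open Literature.MathematicalPhysics.QuantumFieldTheory.Balaban1983to89
open Literature.MathematicalPhysics.QuantumFieldTheory.Balaban1983to89.B11SectG (BlockNorm HasMaj)
open Literature.MathematicalPhysics.QuantumFieldTheory.Balaban1983to89.B11AxialTransport190 (abs_le_loc_ofBlocks loc_ofBlocks_le)
open Literature.MathematicalPhysics.QuantumFieldTheory.Balaban1983to89.B5Prop11Plancherel (Tor fine unitVec)
open Literature.MathematicalPhysics.QuantumFieldTheory.Balaban1983to89.B6UnitTorusCarrier (unitTorusGeo card_fibre_blockOf)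
open Literature.MathematicalPhysics.QuantumFieldTheory.Balaban1983to89.T4EtaRateCoeffDefect (pull pull_apply fibre mem_fibre)
open Literature.MathematicalPhysics.QuantumFieldTheory.King1986.Torus (blockOf val_blockOf blockOf_over tdistT tdistT_nonneg tdistT_symm)
open Summit.QuantumFields.YangMills.BalabanUVNodes.N15.VectorPiece (kingPr kingPrV kingPr_val kingPrV_eq)
open Summit.QuantumFields.YangMills.BalabanUVNodes.N15.MatrixSpecies (liftMap liftBlk)
open Summit.QuantumFields.YangMills.BalabanUVNodes.N15.DefectKernel (card_fibre_kingProj)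
open Summit.QuantumFields.YangMills.BalabanUVNodes.N15.TwoGrid (tdistT_blockOf_add_smul_le kingPr_add_smul_unitVec kingPr_add_smul_unitVec_of_le)

variable {d : ℕ}

/-! ## §1 Two-grid arithmetic: the fine line over the coarse line, the fine block over the coarse block -/

section Arith

/-- `Σ_{s′ < R·n} f(s′) = Σ_{s<n} Σ_{j<R} f(R·s + j)`. [folklore] -/
theorem sum_range_mul_eq {E : Type} [AddCommMonoid E] (f : ℕ → E) (R n : ℕ) :
    ∑ s' ∈ range (R * n), f s' = ∑ s ∈ range n, ∑ j ∈ range R, f (R * s + j) := by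
  induction n with
  | zero => simp
  | succ n ih => rw [Nat.mul_succ, sum_range_add, ih, sum_range_succ]

variable (M : Fin (d + 1) → ℕ) [∀ μ, NeZero (M μ)] (L k m : ℕ) [NeZero L]

/-- `L^m·s` fine steps are `s` coarse steps under King's pairing: `π(z + L^m s·e′_κ) = πz + s·e_κ`. [cite: King1986, p.664 (pairing convention)] -/
theorem kingPr_add_mul_smul (z : Tor (fine (L ^ m * L ^ k) M)) (κ : Fin (d + 1)) (s : ℕ) :
    kingPr L k m M (z + (L ^ m * s) • unitVec (fine (L ^ m * L ^ k) M) κ) = kingPr L k m M z + s • unitVec (fine (L ^ k) M) κ := by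
  induction s with
  | zero => simp
  | succ s ih => rw [Nat.mul_succ, add_smul, ← add_assoc, kingPr_add_smul_unitVec, ih, add_smul, one_smul, add_assoc]

/-- … and backwards: `π(z − L^m s·e′_κ) = πz − s·e_κ`. [cite: King1986, p.664 (pairing convention)] -/
theorem kingPr_sub_mul_smul (z : Tor (fine (L ^ m * L ^ k) M)) (κ : Fin (d + 1)) (s : ℕ) :
    kingPr L k m M (z - (L ^ m * s) • unitVec (fine (L ^ m * L ^ k) M) κ) = kingPr L k m M z - s • unitVec (fine (L ^ k) M) κ := by
  have h := kingPr_add_mul_smul M L k m (z - (L ^ m * s) • unitVec (fine (L ^ m * L ^ k) M) κ) κ s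
  rw [sub_add_cancel] at h
  rw [h, add_sub_cancel_right]

/-- Over a fine point and its projection lies the same unit block: `B(πx′) = B′(x′)`. [cite: King1986, p.664 («x′ ∈ B^n(x)»)] -/
theorem blockOf_kingPr (x' : Tor (fine (L ^ m * L ^ k) M)) : blockOf (L ^ k) M (kingPr L k m M x') = blockOf (L ^ m * L ^ k) M x' :=
  (blockOf_over M (kingPr L k m M x') x' (fun μ => kingPr_val L k m M x' μ)).symm

/-- THE FINE BLOCK OVER THE COARSE BLOCK: `Σ_{x′ ∈ B′(y)} F(πx′) = (L^m)^{d+1}·Σ_{x ∈ B(y)} F(x)` (each coarse point of the unit block has `(L^m)^{d+1}` fine points over it, all in the same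
unit block). [cite: King1986, p.664 (pairing convention)] -/
theorem sum_fibre_fine_eq {E : Type} [AddCommMonoid E] (F : Tor (fine (L ^ k) M) → E) (y : Tor M) :
    ∑ x' ∈ fibre (blockOf (L ^ m * L ^ k) M) y, F (kingPr L k m M x') = ((L ^ m) ^ (d + 1)) • ∑ x ∈ fibre (blockOf (L ^ k) M) y, F x := by
  classical
  have hmaps : ∀ x' ∈ fibre (blockOf (L ^ m * L ^ k) M) y, kingPr L k m M x' ∈ fibre (blockOf (L ^ k) M) y := fun x' hx' => by
    rw [mem_fibre] at hx' ⊢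
    rw [blockOf_kingPr, hx']
  rw [← sum_fiberwise_of_maps_to' hmaps F, smul_sum]
  refine sum_congr rfl fun x hx => ?_
  have hset : (fibre (blockOf (L ^ m * L ^ k) M) y).filter (fun x' => kingPr L k m M x' = x) = fibre (kingPr L k m M) x := by
    ext x'
    simp only [mem_filter, mem_fibre]
    constructor
    · exact fun h => h.2
    · intro h
      exact ⟨by rw [← blockOf_kingPr, h]; exact (mem_fibre _ _ _).mp hx, h⟩
  rw [sum_const, hset, card_fibre_kingProj L k m M (kingPr L k m M) (fun x' μ => kingPr_val L k m M x' μ) x]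

/-- THE BORROW: `j ≤ L^m` fine steps BACKWARDS move the projection by at most one coarse step: `π(x′ − je′_κ) = πx′ − δ′e_κ`, `δ′ ≤ 1`. [cite: King1986, p.664 (pairing convention)] -/
theorem kingPr_sub_smul_eq (x' : Tor (fine (L ^ m * L ^ k) M)) (κ : Fin (d + 1)) {j : ℕ} (hj : j ≤ L ^ m) :
    ∃ δ : ℕ, δ ≤ 1 ∧ kingPr L k m M (x' - j • unitVec (fine (L ^ m * L ^ k) M) κ) = kingPr L k m M x' - δ • unitVec (fine (L ^ k) M) κ := by
  obtain ⟨δ, hδ, h⟩ := kingPr_add_smul_unitVec_of_le M L k m (x' - j • unitVec (fine (L ^ m * L ^ k) M) κ) κ hj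
  rw [sub_add_cancel] at h
  exact ⟨δ, hδ, by rw [h, add_sub_cancel_right]⟩

end Arith

/-! ## §2 The two-grid defect of the average shape -/

section Average

variable {L : ℕ} [NeZero L] (M : Fin (d + 1) → ℕ) [∀ μ, NeZero (M μ)] (k m : ℕ) {ι : Type} [Fintype ι]

/-- THE FINE AVERAGE OF A PROLONGED FIELD, RE-INDEXED OVER THE COARSE LINE: `(Q′_{W′} P̂u)((y, μ), i) = n′^{−(d+1)} Σ_{x′∈B′(y)} n′⁻¹ Σ_{s<L^k} Σ_{j<L^m} Σ_c W′(x′, μ)(L^ms + j)_{ic} ·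
u((π(x′ + (L^ms + j)e′_μ), μ), c)`. [folklore] -/
theorem qvKer_pull_apply_eq (W' : Tor (fine (L ^ m * L ^ k) M) × Fin (d + 1) → ℕ → Matrix ι ι ℝ) (u : (Tor (fine (L ^ k) M) × Fin (d + 1)) × ι → ℝ)
    (q : (Tor M × Fin (d + 1)) × ι) :
    qvKer M (L ^ m * L ^ k) W' (pull (liftMap (kingPrV L k m M) ι) u) q =
      (((L ^ m * L ^ k : ℕ) : ℝ) ^ (d + 1))⁻¹ * ∑ x' ∈ fibre (blockOf (L ^ m * L ^ k) M) q.1.1, (((L ^ m * L ^ k : ℕ) : ℝ)⁻¹ *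
        ∑ s ∈ range (L ^ k), ∑ j ∈ range (L ^ m), ∑ c, W' (x', q.1.2) (L ^ m * s + j) q.2 c *
          u ((kingPr L k m M (x' + (L ^ m * s + j) • unitVec (fine (L ^ m * L ^ k) M) q.1.2), q.1.2), c)) := by
  rw [qvKer_apply]
  refine congrArg _ (sum_congr rfl fun x' _ => congrArg _ ?_)
  exact sum_range_mul_eq (fun s => ∑ c, W' (x', q.1.2) s q.2 c *
    pull (liftMap (kingPrV L k m M) ι) u ((x' + s • unitVec (fine (L ^ m * L ^ k) M) q.1.2, q.1.2), c)) (L ^ m) (L ^ k)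

/-- THE COARSE AVERAGE, RE-INDEXED OVER THE FINE BLOCK: `(Q_W u)((y, μ), i) = n′^{−(d+1)} Σ_{x′∈B′(y)} n′⁻¹ Σ_{s<L^k} Σ_{j<L^m} Σ_c W(πx′, μ)(s)_{ic} · u((πx′ + s e_μ, μ), c)` (`(L^m)^{d+1}` fine
points over each coarse one, `L^m` digits `j`). [folklore] -/
theorem qvKer_apply_eq_fine (W : Tor (fine (L ^ k) M) × Fin (d + 1) → ℕ → Matrix ι ι ℝ) (u : (Tor (fine (L ^ k) M) × Fin (d + 1)) × ι → ℝ) (q : (Tor M × Fin (d + 1)) × ι) :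
    qvKer M (L ^ k) W u q =
      (((L ^ m * L ^ k : ℕ) : ℝ) ^ (d + 1))⁻¹ * ∑ x' ∈ fibre (blockOf (L ^ m * L ^ k) M) q.1.1, (((L ^ m * L ^ k : ℕ) : ℝ)⁻¹ *
        ∑ s ∈ range (L ^ k), ∑ _j ∈ range (L ^ m), ∑ c, W (kingPr L k m M x', q.1.2) s q.2 c *
          u ((kingPr L k m M x' + s • unitVec (fine (L ^ k) M) q.1.2, q.1.2), c)) := by
  have hL : (L : ℝ) ≠ 0 := Nat.cast_ne_zero.mpr (NeZero.ne L)
  have hc1 : ((((L ^ m * L ^ k : ℕ) : ℝ)) ^ (d + 1))⁻¹ * ((((L ^ m) ^ (d + 1) : ℕ) : ℝ)) = ((((L ^ k : ℕ) : ℝ)) ^ (d + 1))⁻¹ := by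
    have h1 : ((L : ℝ) ^ m) ^ (d + 1) ≠ 0 := by positivity
    push_cast
    rw [mul_pow, mul_inv, mul_assoc, mul_comm (((L : ℝ) ^ k) ^ (d + 1))⁻¹, ← mul_assoc, inv_mul_cancel₀ h1, one_mul]
  have hc2 : (((L ^ m * L ^ k : ℕ) : ℝ))⁻¹ * ((L ^ m : ℕ) : ℝ) = (((L ^ k : ℕ) : ℝ))⁻¹ := by
    have h1 : (L : ℝ) ^ m ≠ 0 := by positivity
    push_cast
    rw [mul_inv, mul_assoc, mul_comm ((L : ℝ) ^ k)⁻¹, ← mul_assoc, inv_mul_cancel₀ h1, one_mul]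
  rw [qvKer_apply, sum_fibre_fine_eq M L k m (fun x => (((L ^ m * L ^ k : ℕ) : ℝ)⁻¹ * ∑ s ∈ range (L ^ k), ∑ _j ∈ range (L ^ m), ∑ c, W (x, q.1.2) s q.2 c *
    u ((x + s • unitVec (fine (L ^ k) M) q.1.2, q.1.2), c))) q.1.1, nsmul_eq_mul, ← mul_assoc, hc1]
  refine congrArg _ (sum_congr rfl fun x _ => ?_)
  have hin : ∀ s ∈ range (L ^ k), ∑ _j ∈ range (L ^ m), ∑ c, W (x, q.1.2) s q.2 c * u ((x + s • unitVec (fine (L ^ k) M) q.1.2, q.1.2), c) =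
      ((L ^ m : ℕ) : ℝ) * ∑ c, W (x, q.1.2) s q.2 c * u ((x + s • unitVec (fine (L ^ k) M) q.1.2, q.1.2), c) := fun s _ => by
    rw [sum_const, card_range, nsmul_eq_mul]
  rw [sum_congr rfl hin, ← mul_sum, ← mul_assoc, hc2]

/-- THE DIFFERENCE, TERM BY TERM over `(x′, s, j)`. [folklore] -/
theorem qvKer_twoGrid_sub_apply (W' : Tor (fine (L ^ m * L ^ k) M) × Fin (d + 1) → ℕ → Matrix ι ι ℝ) (W : Tor (fine (L ^ k) M) × Fin (d + 1) → ℕ → Matrix ι ι ℝ)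
    (u : (Tor (fine (L ^ k) M) × Fin (d + 1)) × ι → ℝ) (q : (Tor M × Fin (d + 1)) × ι) :
    (qvKer M (L ^ m * L ^ k) W' ∘ₗ pull (liftMap (kingPrV L k m M) ι) - qvKer M (L ^ k) W) u q =
      (((L ^ m * L ^ k : ℕ) : ℝ) ^ (d + 1))⁻¹ * ∑ x' ∈ fibre (blockOf (L ^ m * L ^ k) M) q.1.1, (((L ^ m * L ^ k : ℕ) : ℝ)⁻¹ *
        ∑ s ∈ range (L ^ k), ∑ j ∈ range (L ^ m),
          (∑ c, W' (x', q.1.2) (L ^ m * s + j) q.2 c * u ((kingPr L k m M (x' + (L ^ m * s + j) • unitVec (fine (L ^ m * L ^ k) M) q.1.2), q.1.2), c) -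
            ∑ c, W (kingPr L k m M x', q.1.2) s q.2 c * u ((kingPr L k m M x' + s • unitVec (fine (L ^ k) M) q.1.2, q.1.2), c))) := by
  rw [LinearMap.sub_apply, LinearMap.comp_apply, Pi.sub_apply, qvKer_pull_apply_eq, qvKer_apply_eq_fine M k m, ← mul_sub, ← sum_sub_distrib]
  refine congrArg _ (sum_congr rfl fun x' _ => ?_)
  rw [← mul_sub, ← sum_sub_distrib]
  refine congrArg _ (sum_congr rfl fun s _ => ?_)
  rw [← sum_sub_distrib]

/-- ★★ **THE TWO-GRID η-DEFECT OF THE AVERAGE SHAPE**: a coarse kernel `W` with rows `≤ B` (`s ≤ L^k`) and a fine kernel `W′` FITTING its projected coarse partner —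
`Σ_c |(W′(x′, μ)(L^ms + j) − W(πx′, μ)(s + δ))_{ic}| ≤ φ` whenever `π(x′ + je′_μ) = πx′ + δe_μ`, `δ ≤ 1`, `s < L^k`, `j < L^m` — give
`Q′_{W′}∘P̂ − Q_W ≤ (φ + 2B∕L^k)·e^{ρ′}·e^{−ρ′|y−y′|_T}` from coarse coloured 1-forms (unit blocks) into unit-lattice ones, for every `ρ′ ≥ 0`: the fine multiplicities over each
coarse line term are exact except one telescoping boundary term per fine line. [cite: King1986, Prop. 3.9 (3.73) p.665 (shape of the two-grid comparison); Balaban1984PropagatorsI, (1.18) p.20] -/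
theorem hasMaj_qvKer_twoGrid {W' : Tor (fine (L ^ m * L ^ k) M) × Fin (d + 1) → ℕ → Matrix ι ι ℝ} {W : Tor (fine (L ^ k) M) × Fin (d + 1) → ℕ → Matrix ι ι ℝ}
    {B φ ρ' : ℝ} (hB : 0 ≤ B) (hφ : 0 ≤ φ) (hρ' : 0 ≤ ρ')
    (hW : ∀ p s, s ≤ L ^ k → ∀ i, ∑ c, |W p s i c| ≤ B)
    (hfit : ∀ (x' : Tor (fine (L ^ m * L ^ k) M)) (μ : Fin (d + 1)) (s j δ : ℕ), s < L ^ k → j < L ^ m → δ ≤ 1 →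
      kingPr L k m M (x' + j • unitVec (fine (L ^ m * L ^ k) M) μ) = kingPr L k m M x' + δ • unitVec (fine (L ^ k) M) μ →
      ∀ i, ∑ c, |(W' (x', μ) (L ^ m * s + j) - W (kingPr L k m M x', μ) (s + δ)) i c| ≤ φ) :
    HasMaj (BlockNorm.ofBlocks (unitTorusGeo L k M) (liftBlk (fun b : Tor (fine (L ^ k) M) × Fin (d + 1) => blockOf (L ^ k) M b.1) ι))
      (BlockNorm.ofBlocks (unitTorusGeo L k M) (liftBlk (fun b : Tor M × Fin (d + 1) => b.1) ι))
      (qvKer M (L ^ m * L ^ k) W' ∘ₗ pull (liftMap (kingPrV L k m M) ι) - qvKer M (L ^ k) W)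
      (fun y y' => (φ + 2 * B / (L ^ k : ℕ)) * Real.exp ρ' * Real.exp (-(ρ' * tdistT M y y'))) := by
  classical
  intro y₁ u hu y
  set b₁ := (BlockNorm.ofBlocks (unitTorusGeo L k M) (liftBlk (fun b : Tor (fine (L ^ k) M) × Fin (d + 1) => blockOf (L ^ k) M b.1) ι)).loc y₁ u with hb₁
  have hU0 : 0 ≤ b₁ := BlockNorm.loc_nonneg _ _ _
  have hn : (0 : ℝ) < ((L ^ k : ℕ) : ℝ) := by exact_mod_cast pow_pos (Nat.pos_of_ne_zero (NeZero.ne L)) k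
  have hn' : (0 : ℝ) < ((L ^ m * L ^ k : ℕ) : ℝ) := by exact_mod_cast Nat.mul_pos (pow_pos (Nat.pos_of_ne_zero (NeZero.ne L)) m) (pow_pos (Nat.pos_of_ne_zero (NeZero.ne L)) k)
  have hK0 : 0 ≤ (φ + 2 * B / (L ^ k : ℕ)) * Real.exp ρ' * Real.exp (-(ρ' * tdistT M y y₁)) := by positivity
  refine loc_ofBlocks_le _ _ (mul_nonneg hK0 hU0) fun q hq => ?_
  obtain ⟨⟨y₀, μ⟩, i⟩ := q
  change y₀ = y at hq
  subst hq
  -- the input: `|u p| ≤ b₁` on its block, `0` elsewhere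
  have hub : ∀ p : (Tor (fine (L ^ k) M) × Fin (d + 1)) × ι, |u p| ≤ (if blockOf (L ^ k) M p.1.1 = y₁ then b₁ else 0) := fun p => by
    split_ifs with hp
    · exact abs_le_loc_ofBlocks (g := unitTorusGeo L k M) (liftBlk (fun b : Tor (fine (L ^ k) M) × Fin (d + 1) => blockOf (L ^ k) M b.1) ι) u hp
    · rw [hu p (by simpa [liftBlk] using hp), abs_zero]
  -- both operators re-indexed over (x′, s, j)
  rw [qvKer_twoGrid_sub_apply M k m]
  -- per fine base point and digit: fit + one telescoping boundary term
  have hline : ∀ x' ∈ fibre (blockOf (L ^ m * L ^ k) M) y₀, ∀ j ∈ range (L ^ m),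
      |∑ s ∈ range (L ^ k), (∑ c, W' (x', μ) (L ^ m * s + j) i c * u ((kingPr L k m M (x' + (L ^ m * s + j) • unitVec (fine (L ^ m * L ^ k) M) μ), μ), c) -
        ∑ c, W (kingPr L k m M x', μ) s i c * u ((kingPr L k m M x' + s • unitVec (fine (L ^ k) M) μ, μ), c))| ≤
      ((L ^ k : ℕ) : ℝ) * φ * (Real.exp ρ' * Real.exp (-(ρ' * tdistT M y₀ y₁)) * b₁) + 2 * B * (Real.exp ρ' * Real.exp (-(ρ' * tdistT M y₀ y₁)) * b₁) := by
    intro x' hx' j hj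
    have hjL : j ≤ L ^ m := (mem_range.mp hj).le
    obtain ⟨δ, hδ1, hδ⟩ := kingPr_add_smul_unitVec_of_le M L k m x' μ hjL
    set x₀ := kingPr L k m M x' with hx₀
    have hx₀y : blockOf (L ^ k) M x₀ = y₀ := by rw [hx₀, blockOf_kingPr]; exact (mem_fibre _ _ _).mp hx'
    -- the fine bond points project to `x₀ + (s + δ)e`
    have hproj : ∀ s : ℕ, kingPr L k m M (x' + (L ^ m * s + j) • unitVec (fine (L ^ m * L ^ k) M) μ) = x₀ + (s + δ) • unitVec (fine (L ^ k) M) μ := fun s => by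
      rw [add_smul, add_comm ((L ^ m * s) • _), ← add_assoc, kingPr_add_mul_smul, hδ, add_assoc, ← add_smul, add_comm δ s]
    -- the value of the input at `x₀ + t e`, `t ≤ L^k`, is bounded by `e^{ρ′}e^{−ρ′d}·b₁` (zero unless the block is `y₁`, then `d ≤ 1`)
    have hval : ∀ t : ℕ, t ≤ L ^ k → ∀ c, |u ((x₀ + t • unitVec (fine (L ^ k) M) μ, μ), c)| ≤ Real.exp ρ' * Real.exp (-(ρ' * tdistT M y₀ y₁)) * b₁ := fun t ht c => by
      refine (hub _).trans ?_
      split_ifs with hp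
      · have hd : tdistT M y₀ y₁ ≤ 1 := by
          rw [← hx₀y, ← hp, tdistT_symm]
          exact tdistT_blockOf_add_smul_le M (L ^ k) x₀ μ ht
        exact le_mul_of_one_le_left hU0 (one_le_exp_mul_exp_of_le_one hρ' hd)
      · positivity
    set g : ℕ → ℝ := fun t => ∑ c, W (x₀, μ) t i c * u ((x₀ + t • unitVec (fine (L ^ k) M) μ, μ), c) with hg
    have hgb : ∀ t, t ≤ L ^ k → |g t| ≤ B * (Real.exp ρ' * Real.exp (-(ρ' * tdistT M y₀ y₁)) * b₁) := fun t ht => by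
      calc |g t| ≤ ∑ c, |W (x₀, μ) t i c| * |u ((x₀ + t • unitVec (fine (L ^ k) M) μ, μ), c)| :=
            (abs_sum_le_sum_abs _ _).trans (le_of_eq (sum_congr rfl fun c _ => abs_mul _ _))
        _ ≤ ∑ c, |W (x₀, μ) t i c| * (Real.exp ρ' * Real.exp (-(ρ' * tdistT M y₀ y₁)) * b₁) :=
            sum_le_sum fun c _ => mul_le_mul_of_nonneg_left (hval t ht c) (abs_nonneg _)
        _ ≤ B * (Real.exp ρ' * Real.exp (-(ρ' * tdistT M y₀ y₁)) * b₁) := by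
            rw [← sum_mul]; exact mul_le_mul_of_nonneg_right (hW _ t ht i) (by positivity)
    -- split each summand: fit term + telescoping term
    have hsplit : ∀ s ∈ range (L ^ k),
        (∑ c, W' (x', μ) (L ^ m * s + j) i c * u ((kingPr L k m M (x' + (L ^ m * s + j) • unitVec (fine (L ^ m * L ^ k) M) μ), μ), c) -
          ∑ c, W (x₀, μ) s i c * u ((x₀ + s • unitVec (fine (L ^ k) M) μ, μ), c)) =
        (∑ c, (W' (x', μ) (L ^ m * s + j) - W (x₀, μ) (s + δ)) i c * u ((x₀ + (s + δ) • unitVec (fine (L ^ k) M) μ, μ), c)) + (g (s + δ) - g s) := by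
      intro s _
      rw [hproj s, hg]
      simp only [Matrix.sub_apply, sub_mul, sum_sub_distrib]
      ring
    rw [sum_congr rfl hsplit, sum_add_distrib]
    have hfitS : |∑ s ∈ range (L ^ k), ∑ c, (W' (x', μ) (L ^ m * s + j) - W (x₀, μ) (s + δ)) i c * u ((x₀ + (s + δ) • unitVec (fine (L ^ k) M) μ, μ), c)| ≤
        ((L ^ k : ℕ) : ℝ) * φ * (Real.exp ρ' * Real.exp (-(ρ' * tdistT M y₀ y₁)) * b₁) := by
      calc _ ≤ ∑ s ∈ range (L ^ k), |∑ c, (W' (x', μ) (L ^ m * s + j) - W (x₀, μ) (s + δ)) i c * u ((x₀ + (s + δ) • unitVec (fine (L ^ k) M) μ, μ), c)| :=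
            abs_sum_le_sum_abs _ _
        _ ≤ ∑ _s ∈ range (L ^ k), φ * (Real.exp ρ' * Real.exp (-(ρ' * tdistT M y₀ y₁)) * b₁) := sum_le_sum fun s hs => by
            have hsn : s < L ^ k := mem_range.mp hs
            calc _ ≤ ∑ c, |(W' (x', μ) (L ^ m * s + j) - W (x₀, μ) (s + δ)) i c| * |u ((x₀ + (s + δ) • unitVec (fine (L ^ k) M) μ, μ), c)| :=
                  (abs_sum_le_sum_abs _ _).trans (le_of_eq (sum_congr rfl fun c _ => abs_mul _ _))
              _ ≤ ∑ c, |(W' (x', μ) (L ^ m * s + j) - W (x₀, μ) (s + δ)) i c| * (Real.exp ρ' * Real.exp (-(ρ' * tdistT M y₀ y₁)) * b₁) :=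
                  sum_le_sum fun c _ => mul_le_mul_of_nonneg_left (hval (s + δ) (by omega) c) (abs_nonneg _)
              _ ≤ φ * (Real.exp ρ' * Real.exp (-(ρ' * tdistT M y₀ y₁)) * b₁) := by
                  rw [← sum_mul]
                  exact mul_le_mul_of_nonneg_right (hfit x' μ s j δ hsn (mem_range.mp hj) hδ1 hδ i) (by positivity)
        _ = _ := by rw [sum_const, card_range, nsmul_eq_mul]; ring
    have htel : |∑ s ∈ range (L ^ k), (g (s + δ) - g s)| ≤ 2 * B * (Real.exp ρ' * Real.exp (-(ρ' * tdistT M y₀ y₁)) * b₁) := by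
      interval_cases δ
      · simp only [add_zero, sub_self, sum_const_zero, abs_zero]; positivity
      · rw [sum_range_sub]
        calc |g (L ^ k) - g 0| ≤ |g (L ^ k)| + |g 0| := abs_sub _ _
          _ ≤ B * _ + B * _ := add_le_add (hgb _ le_rfl) (hgb 0 (Nat.zero_le _))
          _ = _ := by ring
    exact (abs_add_le _ _).trans (add_le_add hfitS htel)
  -- sum the per-line bounds
  rw [abs_mul, abs_inv, abs_of_pos (pow_pos hn' _)]
  have hinner : ∀ x' ∈ fibre (blockOf (L ^ m * L ^ k) M) y₀,
      |(((L ^ m * L ^ k : ℕ) : ℝ))⁻¹ * ∑ s ∈ range (L ^ k), ∑ j ∈ range (L ^ m),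
        (∑ c, W' (x', μ) (L ^ m * s + j) i c * u ((kingPr L k m M (x' + (L ^ m * s + j) • unitVec (fine (L ^ m * L ^ k) M) μ), μ), c) -
          ∑ c, W (kingPr L k m M x', μ) s i c * u ((kingPr L k m M x' + s • unitVec (fine (L ^ k) M) μ, μ), c))| ≤
      (φ + 2 * B / (L ^ k : ℕ)) * Real.exp ρ' * Real.exp (-(ρ' * tdistT M y₀ y₁)) * b₁ := by
    intro x' hx'
    rw [sum_comm, abs_mul, abs_inv, abs_of_pos hn']
    calc (((L ^ m * L ^ k : ℕ) : ℝ))⁻¹ * |∑ j ∈ range (L ^ m), ∑ s ∈ range (L ^ k), _|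
        ≤ (((L ^ m * L ^ k : ℕ) : ℝ))⁻¹ * ∑ j ∈ range (L ^ m), (((L ^ k : ℕ) : ℝ) * φ * (Real.exp ρ' * Real.exp (-(ρ' * tdistT M y₀ y₁)) * b₁) +
            2 * B * (Real.exp ρ' * Real.exp (-(ρ' * tdistT M y₀ y₁)) * b₁)) :=
          mul_le_mul_of_nonneg_left ((abs_sum_le_sum_abs _ _).trans (sum_le_sum fun j hj => hline x' hx' j hj)) (by positivity)
      _ = (φ + 2 * B / (L ^ k : ℕ)) * Real.exp ρ' * Real.exp (-(ρ' * tdistT M y₀ y₁)) * b₁ := by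
          have hL0 : (L : ℝ) ≠ 0 := Nat.cast_ne_zero.mpr (NeZero.ne L)
          rw [sum_const, card_range, nsmul_eq_mul]
          push_cast
          field_simp
  calc ((((L ^ m * L ^ k : ℕ) : ℝ)) ^ (d + 1))⁻¹ * |∑ x' ∈ fibre (blockOf (L ^ m * L ^ k) M) y₀, _|
      ≤ ((((L ^ m * L ^ k : ℕ) : ℝ)) ^ (d + 1))⁻¹ * ∑ x' ∈ fibre (blockOf (L ^ m * L ^ k) M) y₀, (φ + 2 * B / (L ^ k : ℕ)) * Real.exp ρ' * Real.exp (-(ρ' * tdistT M y₀ y₁)) * b₁ :=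
        mul_le_mul_of_nonneg_left ((abs_sum_le_sum_abs _ _).trans (sum_le_sum fun x' hx' => hinner x' hx')) (by positivity)
    _ = (φ + 2 * B / (L ^ k : ℕ)) * Real.exp ρ' * Real.exp (-(ρ' * tdistT M y₀ y₁)) * b₁ := by
        rw [sum_const, card_fibre_blockOf, nsmul_eq_mul, Nat.cast_pow, ← mul_assoc, inv_mul_cancel₀ (pow_pos hn' _).ne', one_mul]

end Average

end Summit.QuantumFields.YangMills.BalabanUVNodes.N15.CovAvg

end
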